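import Summits.CriticalPhenomena.Ising3DConformalLimit.Theorems.LeeYangGapMonotonicityTransfer

/-!
# Free-box block zeros pass to the infinite-volume state (stub `stub_blockZeroOfFreeBoxZeros`)

Route `LeeYangGap` (Ising3DConformalLimit), crux `NearCriticalLeeYangGap` (item stmt-CriticalPhenomena-4945),
line `registered`, stub S1t `stub_blockZeroOfFreeBoxZeros`. THEOREM-ONLY file (no definitions, no named
facts). Nearest-neighbour Ising model on `ℤ³` at inverse temperature `0 ≤ β ≤ β_c(3) = criticalBeta 3`
and zero field; block spin `M_L = Σ_{x ∈ box 3 L} σ_x`; infinite-volume state `⟨·⟩_β = plusExpect 3 β 0`;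
free boxes `⟨·⟩^free_{box 3 N;β,0} = isingExpect (zdGraph 3) (box 3 N) β 0 .free`.

**Claim.** If for every `N ≥ L` the finite-volume block characteristic function
`t ↦ ⟨cos(t M_L)⟩^free_{box 3 N;β,0}` has a zero `t_N ∈ (0, θ]` (`θ > 0`), then the infinite-volume
function `θ' ↦ ⟨cos(θ' M_L)⟩_β` has a zero `θ' ∈ (0, θ]`.

**Proof** (the Hurwitz-free half of `monotonicityTransfer_proof`). Write
`q_N(k) = ⟨1{M_L = k}⟩^free_{box 3 N;β,0}` and `p(k) = ⟨1{M_L = k}⟩⁺_{β,0}`, lattice laws on `[-K, K]`,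
`K = |box 3 L|`. Since `m*(β) = 0` for `0 ≤ β ≤ β_c(3)`
(`spontaneousMagnetization_eq_zero_of_lt_criticalBeta_holds`, `spontaneousMagnetization_criticalBeta_eq_zero_holds`),
the free boxes converge to the plus state on local observables (`tendsto_isingExpect_free_spinFun`), so
`q_N → p` pointwise; and `⟨f(M_L)⟩ = Σ_k (law)_k f(k)` in finite and infinite volume
(`isingExpect_blockFun_eq_sum`, `plusExpect_blockFun_eq_sum`), with `Σ_k p(k) = 1`
(`sum_plusExpect_blockInd`). Suppose `⟨cos(θ' M_L)⟩_β ≠ 0` for all `θ' ∈ (0, θ]`. The continuous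
function `g(s) = Σ_k p(k) cos(sk) = ⟨cos(s M_L)⟩_β` has `g(0) = 1` and no zero on `(0, θ]`, hence
(`exists_pos_le_of_forall_ne_zero`: IVT, compactness, continuity at `θ`) `g ≥ c > 0` on `[0, θ + η]`
for some `0 < η < θ`; by the uniform convergence of the finite cosine sums
(`eventually_forall_cosSum_pos`) the finite-volume functions `s ↦ ⟨cos(s M_L)⟩^free_{box 3 N;β,0}`
are `> 0` on `[0, θ + η]` for all large `N`. Taking such an `N ≥ L`, the hypothesis supplies a zero
`t_N ∈ (0, θ] ⊆ [0, θ + η]` of that very function — contradiction.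

## References

* F. Camia, J. Jiang, C. M. Newman, CMP 401 (2023) 2459, Thm 2 and its proof.
* S. Friedli, Y. Velenik, *Statistical Mechanics of Lattice Systems* (CUP 2017), Thm 3.17,
  Def. 3.32.
* M. Aizenman, H. Duminil-Copin, V. Sidoravicius, CMP 334 (2015), Thm 1.2.
-/

noncomputable section

namespace Summit.CriticalPhenomena.Ising3DConformalLimit.LeeYangGapNearCriticalLeeYangGap

open Literature.Probability.LatticeModels Filter Set Finset MeasureTheory
open scoped Topology BigOperators
open Summit.CriticalPhenomena.Ising3DConformalLimit.PerfectScreeningCoulombImpliesNontrivial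
open Summit.CriticalPhenomena.Ising3DConformalLimit.Theorems.LeeYangGapMonotonicityTransfer

/-- **S1t `stub_blockZeroOfFreeBoxZeros`: free-box block zeros pass to the infinite-volume state.**
For `0 ≤ β ≤ β_c(3)` and `θ > 0`: if for every `N ≥ L` the function
`t ↦ ⟨cos(t M_L)⟩^free_{box 3 N;β,0}`, `M_L = Σ_{x ∈ box 3 L} σ_x`, vanishes at some `t ∈ (0, θ]`,
then `θ' ↦ plusExpect 3 β 0 (cos(θ' M_L))` vanishes at some `θ' ∈ (0, θ]`. Proof (file header):
`m*(β) = 0`, so the block-spin laws under the free boxes converge to the plus-state law; were the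
infinite-volume function zero-free on `(0, θ]` it would be `≥ c > 0` on `[0, θ + η]`, hence so would
be the finite-volume functions for all large `N`, contradicting the hypothesis at a large `N ≥ L`. -/
theorem stub_blockZeroOfFreeBoxZeros :
    ∀ (L : ℕ) (β θ : ℝ), 0 ≤ β → β ≤ Literature.Probability.LatticeModels.criticalBeta 3 → 0 < θ →
      (∀ N : ℕ, L ≤ N → ∃ t : ℝ, 0 < t ∧ t ≤ θ ∧
        Literature.Probability.LatticeModels.isingExpect (Literature.Probability.LatticeModels.zdGraph 3)
          (Literature.Probability.LatticeModels.box 3 N) β 0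
          Literature.Probability.LatticeModels.BoundaryCondition.free
          (fun σ => Real.cos (t * ∑ x ∈ Literature.Probability.LatticeModels.box 3 L,
            Literature.Probability.LatticeModels.spinAt x σ)) = 0) →
      ∃ θ' : ℝ, 0 < θ' ∧ θ' ≤ θ ∧
        Literature.Probability.LatticeModels.plusExpect 3 β 0 (fun σ => Real.cos (θ' *
          ∑ x ∈ Literature.Probability.LatticeModels.box 3 L,
            Literature.Probability.LatticeModels.spinAt x σ)) = 0 := by
  intro L β θ₀ hβ hβc hθ₀ hzeros
  set B : Finset (Site 3) := box 3 L with hB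
  set S : Finset ℤ := Finset.Icc (-(#B : ℤ)) (#B) with hS
  -- `m*` vanishes on `[0, β_c(3)]`
  have hm : spontaneousMagnetization 3 β = 0 := by
    rcases hβc.lt_or_eq with hlt | heq
    · exact spontaneousMagnetization_eq_zero_of_lt_criticalBeta_holds (d := 3) (β := β) hβ hlt
    · rw [heq]
      exact spontaneousMagnetization_criticalBeta_eq_zero_holds (d := 3) le_rfl
  -- a plus Gibbs measure (linearity of the plus state on block functions)
  obtain ⟨μ, hμG, -, hμ⟩ := exists_plusMeasure_holds (d := 3) (β := β) (h := (0 : ℝ)) hβ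
  haveI : IsProbabilityMeasure μ :=
    ((mem_isingGibbsMeasures_iff 3 _ 0 μ).1 hμG).isProbabilityMeasure
  -- the lattice laws of the block spin, in the plus state and in the free boxes
  set p : ℤ → ℝ := fun k => plusExpect 3 β 0
    (fun σ => if (∑ x ∈ B, spinAt x σ) = (k : ℝ) then (1 : ℝ) else 0) with hp
  set q : ℕ → ℤ → ℝ := fun N k => isingExpect (zdGraph 3) (box 3 N) β 0 .free
    (fun σ => if (∑ x ∈ B, spinAt x σ) = (k : ℝ) then (1 : ℝ) else 0) with hq
  have hlim : ∀ k, Tendsto (fun N => q N k) atTop (𝓝 (p k)) := fun k =>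
    tendsto_isingExpect_free_spinFun hβ hm B
      (fun s => if (∑ x ∈ B, s x) = (k : ℝ) then (1 : ℝ) else 0)
      (fun _ _ hst => by rw [Finset.sum_congr rfl hst])
  have hp1 : ∑ k ∈ S, p k = 1 := sum_plusExpect_blockInd hβ hμ B
  -- `⟨cos(s M_L)⟩` as cosine sums against the laws
  have hcos_plus : ∀ s : ℝ, plusExpect 3 β 0 (fun σ => Real.cos (s * ∑ x ∈ B, spinAt x σ)) =
      ∑ k ∈ S, p k * Real.cos (s * k) := fun s =>
    plusExpect_blockFun_eq_sum hβ hμ B (fun m => Real.cos (s * m))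
  have hcos_fin : ∀ (N : ℕ) (s : ℝ),
      isingExpect (zdGraph 3) (box 3 N) β 0 .free (fun σ => Real.cos (s * ∑ x ∈ B, spinAt x σ)) =
        ∑ k ∈ S, isingExpect (zdGraph 3) (box 3 N) β 0 .free
          (fun σ => if (∑ x ∈ B, spinAt x σ) = (k : ℝ) then (1 : ℝ) else 0) * Real.cos (s * k) :=
    fun N s => isingExpect_blockFun_eq_sum (box 3 N) B β .free (fun m => Real.cos (s * m))
  -- contrapositive
  by_contra hno
  push Not at hno
  -- a positive margin for `s ↦ ⟨cos(s M_L)⟩_β` on `[0, θ₀ + η]`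
  obtain ⟨c, η, hc, hη, -, hcle⟩ := exists_pos_le_of_forall_ne_zero
    (g := fun s => ∑ k ∈ S, p k * Real.cos (s * k)) (by fun_prop)
    (by simp [hp1]) hθ₀
    (fun s hs hsθ => by rw [← hcos_plus s]; exact hno s hs hsθ)
  -- finite-volume positivity on `[0, θ₀ + η]` for large `N`
  have hE1 : ∀ᶠ N in atTop, ∀ s ∈ Set.Icc 0 (θ₀ + η), 0 < ∑ k ∈ S, q N k * Real.cos (s * k) :=
    eventually_forall_cosSum_pos hlim hc hcle
  obtain ⟨N, hN1, hNL⟩ := (hE1.and (eventually_ge_atTop L)).exists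
  -- the hypothesis' zero `t ∈ (0, θ₀]` in the free box `box 3 N` contradicts positivity
  obtain ⟨t, htpos, htle, htz⟩ := hzeros N hNL
  have htle' : t ≤ θ₀ + η := by linarith
  have hpos := hN1 t ⟨htpos.le, htle'⟩
  rw [hcos_fin] at htz
  exact hpos.ne' htz

end Summit.CriticalPhenomena.Ising3DConformalLimit.LeeYangGapNearCriticalLeeYangGap

end
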